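import Mathlib
import HarnessLib
import HarnessLib.Audit
import Summits.HubbardSuperconductivity.Statement
import HarnessLib.Audit.Status.Attr

/-!
Route: CooperPairDMottWalk

DORMANT since 2026-08-26T12:05:39Z (reconciler: no traction for 8.2 d (last activity item-evidence-added at 2026-08-18T07:56:28Z); parked, not closed — `ledger route dormant route-HubbardSuperconductivity-CooperPairDMottWalk --off` to r) — unstaffed, not closed; items shared with open routes are served there. `ledger route dormant <id> --off` reactivates.

Route CooperPairDMottWalk — realises idea card cooper-theorem-breathing-self-dual
(HubbardSuperconductivity/HubbardSuperconductivity).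

## Thesis X (it suffices to show) = decl `PureCooperPair`
For some repulsion U ∈ [2, 8] the PURE model (t = 1, t' = 0; `hubbardTorus 2 L 1 U`) on the square
tori of side L ∈ 4ℕ+4 carries, UNIFORMLY IN L, a d_{x²-y²} Cooper pair of two doped holes on top of
the half-filled antiferromagnet:
 (a) pair binding: E_L(L²-2, S^z=0) + E_L(L², 0) + ε ≤ 2·E_L(L²-1, 1/2) with ε > 0 independent of L
(E_L(N, M) = `minEnergyOn (szSector N M)`; 2E(N-1) - E(N) - E(N-2) is the pair-binding energy of the
cluster literature);
 (b) the ground state ψ₂ of the sector (L²-2, S^z = 0) is unique up to phase;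
 (c) macroscopic d-wave pair amplitude against the (Lieb-unique) half-filled ground state ψ₀: |⟨ψ₂,
Δ_d ψ₀⟩|² ≥ z·L²·‖ψ₀‖²‖ψ₂‖², z > 0 independent of L (Δ_d = `pairField dWaveFormFactor L`). With (b)
and Lieb's theorem, (c) says exactly: ψ₂ is a zero-momentum spin singlet of B₁g symmetry relative to
ψ₀ whose pair wavefunction has non-vanishing nearest-neighbour d-wave weight — hypothesis (P) of the
BEC-side programme (card dilute-pair-bec-bridge), typed over existing declarations.
X → S is crux `DiluteBECBridge` (bound, dilute, d-wave hole pairs condense at small hole density δ: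
for every U ∈ [2,8], (a)∧(b)∧(c) ⇒ ∃ δ ∈ (0, 1/2) with `HasDWavePairFieldLROAt U δ`, word for word
the summit's body), and `Assembly : CooperPairDMott → BindingWalk → DiluteBECBridge →
HubbardSuperconductivity` is pure logic (checked in the planner's sketch).

## The line of attack on X (what this route adds)
Prove the Cooper pair as a THEOREM where the parent insulator is controlled, then walk it home. The
breathing / checkerboard family H_L(a, b, U) = -a·T_intra - b·T_inter + U·Σ n↑n↓ (T_intra:
nearest-neighbour hopping inside the 2×2 plaquettes {2m,2m+1}², T_inter: the remaining torus bonds;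
in Lean `hamiltonian (fermionTorusGraph 2 L \ ⊤.comap plaq) a U + hamiltonian (fermionTorusGraph 2 L
⊓ ⊤.comap plaq) b 0`, plaq x = (⌊x₁/2⌋, ⌊x₂/2⌋)) has: (i) at b → 0, a = 1, 2 ≤ U ≤ 4 < U_c ≈ 4.58 a
d-Mott insulator parent (product of plaquette singlets, unique and gapped) whose two doped holes
bind into ONE plaquette in the B₁g channel with binding energy Δ_p(U) > 0 [TsaiKivelson2006,
YaoTsaiKivelson2007] — crux `CooperPairDMott` asserts (a)∧(b)∧(c) for H_L(1, b, U), all U ∈ [2,4],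
all 0 < b < b₀(U), uniformly in L: a few-body spectral problem inside a gapped phase reachable by
convergent perturbation theory / fermionic gap-stability [DattaFernandezFrohlich1999,
Koma2020GapStability, doi:10.1007/s00220-005-1456-9, arXiv:1712.00977]; (ii) H_L(1, 1, U) IS the
pure model (support `BreathingAtOneIsPure`) and H_L(a, b, U) ≅ H_L(b, a, U) by the diagonal
translation for every even L ≥ 4 (support `BreathingSelfDualFourLe`; the all-even-L form
`BreathingSelfDual` was refuted AS TYPED at the degenerate side L = 2 — one plaquette = the whole
2×2 torus — and dropped at rev 8; the route only uses L = 4k+4): the pure model is the self-dual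
point of the family; (iii) crux `BindingWalk`: the Cooper pair proved at the plaquette end persists
along the family to (a, b) = (1, 1) for some U ∈ [2, 8] (pair binding is numerically positive along
the whole path and maximal at intermediate b [arXiv:0803.0933, doi:10.1103/physrevb.83.054508]).

Lean, X in one line (elaborates; all constants exist — hubbardTorus, szSector, Matrix.minEnergyOn,
IsGroundStateInSector, pairField, dWaveFormFactor):
`open Literature.MathematicalPhysics.QuantumLattice in let CP := fun (L : ℕ) [NeZero L] (H : Matrix
(Finset (Orb (FermionTorus 2 L))) (Finset (Orb (FermionTorus 2 L))) ℂ) (ε z : ℝ) => H.minEnergyOn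
(szSector (L ^ 2 - 2) 0) + H.minEnergyOn (szSector (L ^ 2) 0) + ε ≤ 2 * H.minEnergyOn (szSector (L ^
2 - 1) (1 / 2)) ∧ (∀ φ₁ φ₂, IsGroundStateInSector H (L ^ 2 - 2) 0 φ₁ → IsGroundStateInSector H (L ^
2 - 2) 0 φ₂ → ∃ c : ℂ, φ₂ = c • φ₁) ∧ (∀ φ₀ φ₂, IsGroundStateInSector H (L ^ 2) 0 φ₀ →
IsGroundStateInSector H (L ^ 2 - 2) 0 φ₂ → z * (L : ℝ) ^ 2 * (star φ₀ ⬝ᵥ φ₀).re * (star φ₂ ⬝ᵥ φ₂).re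
≤ ‖star φ₂ ⬝ᵥ (pairField dWaveFormFactor L *ᵥ φ₀)‖ ^ 2); ∃ U ∈ Set.Icc (2 : ℝ) 8, ∃ ε > (0 : ℝ), ∃ z
> (0 : ℝ), ∃ k₀ : ℕ, ∀ k ≥ k₀, CP (4 * k + 4) (hubbardTorus 2 (4 * k + 4) 1 U) ε z`

Rationale: WHY THIS LINE. Every BEC-side attack on S (cards dilute-pair-bec-bridge, eta-spectroscopy-teleport,
b1g-staircase) needs "two doped holes bind, uniformly in L, in the B1g channel" — open for the pure
model because its half-filled parent (the 2D Hubbard antiferromagnet) is uncontrolled. The card's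
move: replace the parent by one that IS controlled and is joined to the pure model INSIDE the
repulsive Hubbard class by a one-parameter family with a symmetry. On the breathing/checkerboard
family H_L(a,b,U) the plaquette end (b ≪ a = 1, U < 4.58) is a d-Mott insulator — a product of 2×2
plaquette singlets dressed by a convergent expansion — and two holes bind into one plaquette with
the explicitly computable binding energy Δ_p(U) = 2E₃ - E₂ - E₄ > 0 and a B1g pair operator
[TsaiKivelson2006; YaoTsaiKivelson2007; Scalapino–Trugman doi:10.1080/01418639608240361]. There the
Cooper problem is a few-body spectral problem below a two-holon threshold inside a gapped phase:
Feshbach–Schur projection onto "both holes on one plaquette", complement bounded below by 2×(holon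
band bottom) - O(b), engines = convergent perturbation theory around a unique gapped product state
[DattaFernandezFrohlich1999; Yarotsky doi:10.1007/s00220-005-1456-9, math-ph/0411042] and fermionic
gap stability / spectral flow [Koma2020GapStability; De Roeck–Salmhofer arXiv:1712.00977; NSY
arXiv:1705.08553; MichalakisZwolakCMP2013]. No expansion in U or t/U, no reflection positivity, no
sign structure. Imported areas: constructive perturbation theory of gapped quantum lattice systems +
few-body threshold spectral analysis; certified ED for the 256-dimensional plaquette data (support
PlaquettePairBinding). The pure model is H_L(1,1,U) (support BreathingAtOneIsPure) and the family is
self-dual under the diagonal translation, H(a,b) ≅ H(b,a) for even L ≥ 4 (support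
BreathingSelfDualFourLe =
Literature.MathematicalPhysics.QuantumLattice.breathingSelfDual_of_four_le, proved; it replaces
BreathingSelfDual, refuted as typed at L = 2 by Theorems.CooperPairDMottWalk.not_breathingSelfDual
and dropped): phase boundaries in b/a come in reciprocal pairs around the pure point.

RANKED CRUXES.
rank 2 `BindingWalk` — the walk: a Cooper pair (binding ε>0, unique two-hole GS, macroscopic d-wave
amplitude, uniform in L ∈ 4ℕ) at the plaquette end for some U₀ ∈ [2,4] and all small b ⟹ the same
for the PURE torus at some U ∈ [2,8]. Decisive and hardest: needs a continuation mechanism for an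
isolated two-body bound state across the parent's plaquette-singlet → Néel transition (the Feshbach
gap closes there; the honest open junction). Evidence: pair binding on breathing 4×4 / CORE clusters
is positive along the whole path and MAXIMAL at intermediate b [arXiv:0803.0933;
doi:10.1103/physrevb.83.054508; DQMC doi:10.1103/PhysRevB.90.075121]; the half-filled family is
sign-free/RP for every (a,b), so the parent is trackable along the path.
rank 3 `CooperPairDMott` — the theorem corner (the card's deliverable, first infinite-volume-uniform
Cooper-pair theorem for purely repulsive electrons): ∀ U ∈ [2,4] ∃ b₀ ∀ b ∈ (0,b₀): (a)∧(b)∧(c) for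
H_L(1,b,U), L ∈ 4ℕ+4 large. Provable with named technology; small parameter b/Δ_p(U) honest (Δ_p ≲
0.04, so b₀ ~ 10⁻²).
rank 4 `DiluteBECBridge` — X → S: ∀ U ∈ [2,8], pure Cooper pair ⟹ ∃ δ ∈ (0,1/2)
HasDWavePairFieldLROAt U δ. Content = (R) low-density reduction to a hard-core d-boson gas ∧ (B)
DiluteBEC of that gas, shared with card dilute-pair-bec-bridge (attach/supersede if that card's
route files the finer split); ranked last here because it is not specific to this line.
Target `PureCooperPair` (rank 0) = X = the walk's endpoint, claimable directly (e.g. large-U/t-J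
corner, certified ED).
Support (rank 9): BreathingAtOneIsPure (edge partition; PROVED), BreathingSelfDualFourLe
(translation unitary U_(1,1), even L ≥ 4; proved in Literature, one-line wrapper attached as
evidence on stmt-HubbardSuperconductivity-15176; the all-even-L BreathingSelfDual is a settled
NEGATIVE edge, witness L = 2), PlaquettePairBinding (certified 4-site computation: strict binding,
unique N=2,4 sector GS, nonzero d-wave matrix element, U ∈ [2,4]); glue (PROVED): CruxesGiveTarget,
TargetSuffices, Assembly — the deciding theorem is closes : CooperPairDMott → BindingWalk →
DiluteBECBridge → CruxesGiveTarget → TargetSuffices → HubbardSuperconductivity.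

KILL CRITERIA. (i) Certified/converged ED on breathing tori (4×4, √20, √32, 6×6 DMRG) showing the
two-hole binding energy of H_L(1,b,U) changes sign at some b* < 1 for EVERY U whose path starts in
the plaquette window, robust to twisted-boundary averaging ⟹ BindingWalk and PureCooperPair die,
route closes refuted:BindingWalk (CooperPairDMott survives as Literature). (ii) A proof that the
unique two-hole GS at the plaquette end has pair momentum (π,π) (negative effective pair hopping) ⟹
clause (c) of CooperPairDMott is false as stated; repair = restate (c) with the staggered d-wave
pair field (then the bridge changes too). (iii) Hole-crystal / pair-charge-gap ground states
persisting to δ → 0 for all U ∈ [2,8] in the pure model ⟹ DiluteBECBridge dies (stripe barrier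
reaches the underdoped edge).

DELIBERATELY NOT DECOMPOSED YET. (T1) parent uniqueness/gap/clustering and (T2) the one-holon band
are lemmas under CooperPairDMott (provers attach them with --supports); the infinite-volume GNS
formulation of the Cooper theorem; the split of DiluteBECBridge into (R) and (B); any intermediate-b
statement of the walk (a glued split BindingWalk ↦ {plaquette-to-b₁, b₁-to-1} waits for
CooperPairDMott's explicit b₀ and for refuter ED data locating the parent transition b_AF(U)).
CHEAPEST FALSIFIER. Converged Lanczos ED of the two-hole pair-binding energy Δ_pb = 2E(15, 1/2) −
E(14, 0) − E(16, 0) (arXiv:0803.0933 eq. (2) at x = 1/16) of the breathing 4×4 torus H_4(1, b, U) at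
U ∈ {2, 3, 4} on a grid of b ∈ (0, 1] (sector dimensions ≤ C(16,8)² ≈ 1.7·10⁸, ≈ 10⁷ per momentum
block) — the PBC contour of arXiv:0803.0933 Fig. 2(a) over (U, t′), with the twisted-PBC check of
its Fig. 3 extended from U = 8 down to U ∈ [2, 4]: a sign change of Δ_pb at some b* < 1 for EVERY
such U, stable under the boundary twist, kills BindingWalk and the target PureCooperPair (kill
criterion (i)). Cheaper still, the 256-dimensional plaquette numbers (support PlaquettePairBinding):
Δ_p(U) ≤ 0 or m_d(U) = 0 anywhere on U ∈ [2, 4] kills CooperPairDMott as quantified (∀ U ∈ [2,4]);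
TsaiKivelson2006 gives Δ_p > 0 exactly on 0 < U < 4.58.
NOVELTY / BARRIERS: see the dedicated sections (searched: card's audit trail + this session's
lit/galaxy queries logged in the planner NOTES).

Novelty: NEAREST PRIOR: TsaiKivelson2006 + YaoTsaiKivelson2007 (checkerboard/plaquette Hubbard: d-Mott
insulator, plaquette pair binding Δ_p>0 for 0<U<4.58, doped phases perturbative in t'),
arXiv:0803.0933 + doi:10.1103/physrevb.83.054508 (pair binding vs t'/t on 4×4/CORE: positive along
the path, maximal at t'≈0.5t, "t'>0.8t most speculative"), engines DattaFernandezFrohlich1999,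
doi:10.1007/s00220-005-1456-9, arXiv:math-ph/0411042, Koma2020GapStability, arXiv:1712.00977;
rigorous two-particle bound-state templates in OTHER lattice models doi:10.1007/s00220-013-1688-z,
doi:10.1007/s10688-005-0015-7. NOT FOUND: a uniform-in-L / infinite-volume THEOREM that two holes in
a purely repulsive interacting electron system form an isolated zero-momentum B1g bound state below
the two-holon continuum; nor the pure model typed as the self-dual point a=b of the breathing family
with a continuation target. DELTA: (1) CooperPairDMott = that theorem as a typed finite-torus target
(binding + uniqueness + macroscopic d-wave amplitude) in the honest regime b ≪ Δ_p(U), U∈[2,4], with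
a standard proof route (Feshbach onto one-plaquette pairs inside a convergent expansion); (2)
BindingWalk = ONE typed implication from the theorem corner to hypothesis (P) of the BEC bridge for
the pure model, with H(1,1)=pure and H(a,b)≅H(b,a) as provable support; (3) plaquette data as a
certified item. Grade claimed: new-combination (the card's audited grade); the self-duality is Z₂
bookkeeping, not a pinning mechanism.
S  [refs: 10.1103/physrevb.83.054508, 10.1007/s00220-005-1456-9, 10.1007/s00220-013-1688-z, 10.1007/s10688-005-0015-7., 10.1007/s00023-004-0181-9, 10.1063/1.5036751, 10.1090/conm/717, 10.1103/PhysRevB.90.075121, 10.1080/01418639608240361., 0803.0933, math-ph/0411042, 1712.00977, cond-mat/0601113, 0706.0761, 1705.08553, cond-mat/0510738, 2210.02321, doi:10.1103/physrevb.83.054508, doi:10.1007/s00220-005-1456]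

Barriers (technique_class: gapped-phase-perturbation-theory few-body-bound-state): technique_class: gapped-phase-perturbation-theory few-body-bound-state (deformation to the self-dual
point; low-density expansion inside DiluteBECBridge)
- Literature.Barriers.HubbardSuperconductivity.LROForcesLowLyingStates: APPLIES to the engine of
CooperPairDMott (unique gapped ground state + gap stability) and is harmless there: uniqueness/gap
are claimed only for the UNDOPED d-Mott parent at b ≪ 1 and for an isolated TWO-body eigenvalue
below the two-holon continuum — no LRO is asserted in any gapped unique state; at finite density
(DiluteBECBridge) order is stated as fixed-N pair-field LRO of every sector ground state, the
barrier's own evasion (i), and the Koma–Tasaki tower is expected, not excluded.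
- Literature.Barriers.HubbardSuperconductivity.StrongCouplingCeiling: the convergent expansion is in
b/Δ_p(U) around DECOUPLED PLAQUETTES with a unique gapped ground state in each of the sectors used
(N=4; N=2 pair; the N=3 holon doublet is handled as a quasi-particle band), which is exactly the
finitely-degenerate gapped reference state quantum Pirogov–Sinai/DFF theory requires and the atomic
limit t=0 lacks; no t/U or high-temperature expansion. The ceiling's obstruction (gapless SU(2)
bands) reappears only on the WALK at the parent's plaquette-singlet→Néel transition, flagged as
BindingWalk's why-might-fail.
- Literature.Barriers.HubbardSuperconductivity.PureModelStripeCompetition: the witness is (U ∈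
[2,8], δ → 0⁺), not the cuprate box (6–8, 1/8); stripes/hole crystals

History (route lifecycle, newest last):
- 2026-08-15T16:10:27Z · rev 4: restated DiluteBECBridge (stmt-HubbardSuperconductivity-1178) — route-repair (cone, gen 2): decision (a) RE-ROUTE AROUND. The 2 unproved cone facts Literature.Barriers.HubbardSuperconductivity.PureModelStripeCompetition[Rang (planner-rrepair-HubbardSuperconductivity-Coope-ee6cdeab-g2-0)
- 2026-08-16T11:41:21Z · BROKEN — BreathingSelfDual (stmt-HubbardSuperconductivity-1180, support) refuted by Summit.HubbardSuperconductivity.HubbardSuperconductivity.Theorems.CooperPairDMottWalk.not_breathingSelfDual (prover-pitem-stmt-HubbardSuperconductivity-1180-0)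
- 2026-08-16T12:17:43Z · rev 8: dropped BreathingSelfDual — repair (2/2): drop the want of BreathingSelfDual (stmt-HubbardSuperconductivity-1180, support, refuted-misstated by Summit.HubbardSuperconductivity.HubbardSuper (planner-rrefute-HubbardSuperconductivity-Coope-1182b364-0)
- 2026-08-16T12:17:43Z · REPAIRED (drop BreathingSelfDual) — back to open: repair (2/2): drop the want of BreathingSelfDual (stmt-HubbardSuperconductivity-1180, support, refuted-misstated by Summit.HubbardSuperconductivity.HubbardSuper (planner-rrefute-HubbardSuperconductivity-Coope-1182b364-0)
- 2026-08-26T12:05:39Z · DORMANT — reconciler: no traction for 8.2 d (last activity item-evidence-added at 2026-08-18T07:56:28Z); parked, not closed — `ledger route dormant route-HubbardSupercond (operator:999:3953482)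

sub-problem: HubbardSuperconductivity · status: dormant · opened planner-plancard-HubbardSuperconductivity-Hub-b092c06b-0 2026-08-15T10:53:14Z · rev 9 · ledger route-HubbardSuperconductivity-CooperPairDMottWalk
GENERATED by the gate from the ledger (D-0016/17). Provers cite these decls: `theorem foo : Summit.HubbardSuperconductivity.HubbardSuperconductivity.Theses.CooperPairDMottWalk.<Decl> := …` in Summits/HubbardSuperconductivity/HubbardSuperconductivity/Theorems/<Name>.lean.
-/

namespace Summit.HubbardSuperconductivity.HubbardSuperconductivity.Theses.CooperPairDMottWalk

open scoped BigOperators Topology Manifold Classical MeasureTheory ProbabilityTheory Matrix InnerProductSpace ComplexConjugate ContinuousMap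
open Filter Set Function TopologicalSpace MeasureTheory

attribute [summit_statement] _root_.HubbardSuperconductivity

open Literature.Hubbard

/-- item stmt-HubbardSuperconductivity-1175 · target · rank 0 · open · by planner
why it might fail: May fail ∀U≤8: t-J 2-hole d bound state shallow (E_b=−0.05t, J/t=0.3, 32 sites), |E_b| shrinks 16→32 sites, no clean FSS (cond-mat/9806018 §3.2); d ~degenerate with p_(π,π),p_(π,0), crossings for J<0.3t (cond-mat/0201031) threaten (b)/(c) on L=4k+4; 4×4 Hubbard Δ_pb BC-sensitive (0803.0933 p.7).
sources: arXiv:0803.0933, doi:10.1103/physrevb.58.13594, doi:10.1103/physrevb.65.205101, doi:10.1103/PhysRevB.42.6877, LiebPRL1989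
[target] X = hypothesis (P) for the PURE model (t=1, t'=0): for some U in [2,8], uniformly in L =
4k+4: (a) two-hole pair binding E(L^2-2,S^z=0) + E(L^2,0) + eps <= 2 E(L^2-1,1/2), eps>0 (the
cluster literature's Delta_pb = 2E(M)-E(M+1)-E(M-1) at M = 1 hole, arXiv:0803.0933 eq. (2)); (b)
unique ground state of the (L^2-2, S^z=0) sector; (c) macroscopic d_{x^2-y^2} pair amplitude
|<psi_2, Delta_d psi_0>|^2 >= z L^2 |psi_0|^2 |psi_2|^2 against the Lieb-unique half-filled GS
(equivalently: psi_2 is a K=0 singlet, B1g relative to psi_0, with nonzero n.n. d-wave weight). This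
is the walk's endpoint (conclusion of BindingWalk) and the hypothesis of DiluteBECBridge; claimable
directly (certified ED on 4x4/sqrt20/sqrt32 tori decides its fate fast; a large-U/t-J-corner proof
would also close it). Shared in content with card dilute-pair-bec-bridge's (P). Sources:
arXiv:0803.0933, doi:10.1103/physrevb.58.13594, doi:10.1103/PhysRevB.42.6877, LiebPRL1989. -/
@[route_item "route-HubbardSuperconductivity-CooperPairDMottWalk"]
def PureCooperPair : Prop :=
  open Literature.MathematicalPhysics.QuantumLattice in let CP := fun (L : ℕ) [NeZero L] (H : Matrix (Finset (Orb (FermionTorus 2 L))) (Finset (Orb (FermionTorus 2 L))) ℂ) (ε z : ℝ) => H.minEnergyOn (szSector (L ^ 2 - 2) 0) + H.minEnergyOn (szSector (L ^ 2) 0) + ε ≤ 2 * H.minEnergyOn (szSector (L ^ 2 - 1) (1 / 2)) ∧ (∀ φ₁ φ₂, IsGroundStateInSector H (L ^ 2 - 2) 0 φ₁ → IsGroundStateInSector H (L ^ 2 - 2) 0 φ₂ → ∃ c : ℂ, φ₂ = c • φ₁) ∧ (∀ φ₀ φ₂, IsGroundStateInSector H (L ^ 2) 0 φ₀ → IsGroundStateInSector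 H (L ^ 2 - 2) 0 φ₂ → z * (L : ℝ) ^ 2 * (star φ₀ ⬝ᵥ φ₀).re * (star φ₂ ⬝ᵥ φ₂).re ≤ ‖star φ₂ ⬝ᵥ (pairField dWaveFormFactor L *ᵥ φ₀)‖ ^ 2); ∃ U ∈ Set.Icc (2 : ℝ) 8, ∃ ε > (0 : ℝ), ∃ z > (0 : ℝ), ∃ k₀ : ℕ, ∀ k ≥ k₀, CP (4 * k + 4) (hubbardTorus 2 (4 * k + 4) 1 U) ε z

/-- item stmt-HubbardSuperconductivity-1176 · crux · rank 2 · open · by planner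
why it might fail: Fails iff corner true & target false: pure 2-hole binding may →0 as L→∞ for all U≤8 (t-J ED |E_b| shrinks 16→32 sites, naive FSS unbinds at J/t≈0.3: cond-mat/9806018 §3.2; 4×4 Δ_pb BC-sensitive for t'/t>0.8: 0803.0933 p.3,7); parent gap closes at b_AF≈0.74<1 ((J'/J)_c=0.5485, 0808.1418).
sources: arXiv:0803.0933, doi:10.1103/physrevb.58.13594, doi:10.1103/physrevb.79.014410, doi:10.1103/physrevb.65.205101, doi:10.1103/physrevb.83.054508, doi:10.1103/PhysRevB.90.075121
[crux] THE WALK (card cooper-theorem-breathing-self-dual): on the breathing/checkerboard family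
H_L(a,b,U) = -a T_intra - b T_inter + U D (intra = n.n. bonds inside the 2x2 plaquettes {2m,2m+1}^2
of the torus of side L=4k+4, inter = the other n.n. bonds; hopping-free bonds carry no extra
interaction), IF for some U0 in [2,4] and all 0<b<b0 the plaquette-end model H_L(1,b,U0) has a
Cooper pair in the sense (a) binding eps>0, (b) unique (L^2-2,0)-sector GS, (c) macroscopic d-wave
amplitude z L^2, uniformly in L (= the conclusion of CooperPairDMott at U0), THEN the PURE torus
hubbardTorus 2 L 1 U has the same for some U in [2,8] (= PureCooperPair). Method the route proposes:
continuation in (b,U) from the theorem corner to the self-dual point (a,b)=(1,1) (support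
BreathingAtOneIsPure, BreathingSelfDual), tracking the isolated two-hole eigenvalue below the
two-holon threshold; the parent at half filling is sign-free/RP for every (a,b) so its
plaquette-singlet -> Neel transition b_AF(U) can be located; a second binding engine
(string/spin-polaron in the Neel background) must take over past b_AF: that junction is the open
point. Evidence: 4x4 ED pair binding positive along the whole path -/
@[route_item "route-HubbardSuperconductivity-CooperPairDMottWalk", crux]
def BindingWalk : Prop :=
  open Literature.MathematicalPhysics.QuantumLattice in let CP := fun (L : ℕ) [NeZero L] (H : Matrix (Finset (Orb (FermionTorus 2 L))) (Finset (Orb (FermionTorus 2 L))) ℂ) (ε z : ℝ) => H.minEnergyOn (szSector (L ^ 2 - 2) 0) + H.minEnergyOn (szSector (L ^ 2) 0) + ε ≤ 2 * H.minEnergyOn (szSector (L ^ 2 - 1) (1 / 2)) ∧ (∀ φ₁ φ₂, IsGroundStateInSector H (L ^ 2 - 2) 0 φ₁ → IsGroundStateInSector H (L ^ 2 - 2) 0 φ₂ → ∃ c : ℂ, φ₂ = c • φ₁) ∧ (∀ φ₀ φ₂, IsGroundStateInSector H (L ^ 2) 0 φ₀ → IsGroundStateInSector H (L ^ 2 - 2)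 0 φ₂ → z * (L : ℝ) ^ 2 * (star φ₀ ⬝ᵥ φ₀).re * (star φ₂ ⬝ᵥ φ₂).re ≤ ‖star φ₂ ⬝ᵥ (pairField dWaveFormFactor L *ᵥ φ₀)‖ ^ 2); let Hb := fun (L : ℕ) (a b U : ℝ) => hamiltonian (fermionTorusGraph 2 L \ (⊤ : SimpleGraph (Fin 2 → ℕ)).comap (fun (x : FermionTorus 2 L) (i : Fin 2) => (ofLex x i : ℕ) / 2)) a U + hamiltonian (fermionTorusGraph 2 L ⊓ (⊤ : SimpleGraph (Fin 2 → ℕ)).comap (fun (x : FermionTorus 2 L) (i : Fin 2) => (ofLex x i : ℕ) / 2)) b 0; (∃ U₀ ∈ Set.Icc (2 : ℝ) 4, ∃ b₀ > (0 : ℝ), ∀ b ∈ Set.Ioo 0 b₀, ∃ ε > (0 : ℝ), ∃ z > (0 : ℝ), ∃ k₀ : ℕ, ∀ k ≥ k₀, CP (4 * k + 4) (Hb (4 * k + 4) 1 b U₀) ε z) → ∃ U ∈ Set.Icc (2 : ℝ) 8, ∃ ε > (0 : ℝ), ∃ z > (0 : ℝ), ∃ k₀ : ℕ, ∀ k ≥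 k₀, CP (4 * k + 4) (hubbardTorus 2 (4 * k + 4) 1 U) ε z

/-- item stmt-HubbardSuperconductivity-1177 · crux · rank 3 · open · by planner
why it might fail: Tiny scales: plaquette |Δ_p|<0.04t on U∈(0,5), →0 at U_c=4.58 (cond-mat/0108087 p.6; cond-mat/0601113 eq.2) ⇒ b₀≲10⁻²; (c) needs O(b²) pair hopping t⁽¹⁾(U)>0 (K=0 minimum) on [2,4], only |t⁽¹⁾| derived, U-dependence 'complicated' (0706.0761 eq.2); no L-uniform fermionic 2-body construction exists.
sources: TsaiKivelson2006, YaoTsaiKivelson2007, arXiv:cond-mat/0108087, arXiv:0803.0933, DattaFernandezFrohlich1999, doi:10.1007/s00220-005-1456-9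
[crux] COOPER THEOREM IN THE d-MOTT INSULATOR (the card's deliverable; finite-torus form, uniform in
L): for every U in [2,4] (inside the plaquette pair-binding window 0<U<U_c~4.58 of TsaiKivelson2006,
where Delta_p(U) = 2E_3-E_2-E_4 > 0 on the isolated 2x2 plaquette with hopping 1) there is b0(U)>0
such that for all inter-plaquette hopping 0<b<b0 the breathing torus H_L(1,b,U), L=4k+4 large, has
(a) pair binding E(L^2-2,0)+E(L^2,0)+eps <= 2E(L^2-1,1/2) with eps = Delta_p(U) - O(b) > 0, (b) a
unique ground state in the sector (L^2-2, S^z=0) (the (L/2)^2-fold degenerate one-plaquette pair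
states split at O(b^2) into a pair band with unique K=0 minimum), (c) |<psi_2, Delta_d psi_0>|^2 >=
z L^2 |psi_0|^2|psi_2|^2 with z = m_d^2/4 - O(b), m_d the plaquette d-wave matrix element (support
PlaquettePairBinding). Proof route: the half-filled parent is a product of plaquette singlets
dressed by a convergent expansion (unique, gapped, clustering: DattaFernandezFrohlich1999 / Yarotsky
doi:10.1007/s00220-005-1456-9 adapted to even fermionic perturbations, or fermionic gap stability
Koma2020GapStability, arXiv:1712.00977, arXiv:1705.08553); one-holon sector = quasi-particle band of
width O(b) ( -/
@[route_item "route-HubbardSuperconductivity-CooperPairDMottWalk", crux]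
def CooperPairDMott : Prop :=
  open Literature.MathematicalPhysics.QuantumLattice in let CP := fun (L : ℕ) [NeZero L] (H : Matrix (Finset (Orb (FermionTorus 2 L))) (Finset (Orb (FermionTorus 2 L))) ℂ) (ε z : ℝ) => H.minEnergyOn (szSector (L ^ 2 - 2) 0) + H.minEnergyOn (szSector (L ^ 2) 0) + ε ≤ 2 * H.minEnergyOn (szSector (L ^ 2 - 1) (1 / 2)) ∧ (∀ φ₁ φ₂, IsGroundStateInSector H (L ^ 2 - 2) 0 φ₁ → IsGroundStateInSector H (L ^ 2 - 2) 0 φ₂ → ∃ c : ℂ, φ₂ = c • φ₁) ∧ (∀ φ₀ φ₂, IsGroundStateInSector H (L ^ 2) 0 φ₀ → IsGroundStateInSector H (L ^ 2 - 2) 0 φ₂ → z * (L : ℝ) ^ 2 * (star φ₀ ⬝ᵥ φ₀).re * (star φ₂ ⬝ᵥ φ₂).re ≤ ‖star φ₂ ⬝ᵥ (pairField dWaveFormFactor L *ᵥ φ₀)‖ ^ 2); let Hb := fun (L : ℕ) (a b U : ℝ) => hamiltonian (fermionTorusGraph 2 L \ (⊤ : SimpleGraph (Fin 2 → ℕ)).comap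 (fun (x : FermionTorus 2 L) (i : Fin 2) => (ofLex x i : ℕ) / 2)) a U + hamiltonian (fermionTorusGraph 2 L ⊓ (⊤ : SimpleGraph (Fin 2 → ℕ)).comap (fun (x : FermionTorus 2 L) (i : Fin 2) => (ofLex x i : ℕ) / 2)) b 0; ∀ U ∈ Set.Icc (2 : ℝ) 4, ∃ b₀ > (0 : ℝ), ∀ b ∈ Set.Ioo 0 b₀, ∃ ε > (0 : ℝ), ∃ z > (0 : ℝ), ∃ k₀ : ℕ, ∀ k ≥ k₀, CP (4 * k + 4) (Hb (4 * k + 4) 1 b U) ε z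

-- earlier DiluteBECBridge (stmt-HubbardSuperconductivity-1178, replaced 2026-08-15T16:10:27Z -> stmt-HubbardSuperconductivity-10314): retired by None — open Literature.MathematicalPhysics.QuantumLattice in let CP := fun (L : ℕ) [NeZero L] (H : Matrix (Finset (Orb (FermionTorus 2 L))) (Finset (Orb (FermionTorus 2 L))) ℂ) (ε z : ℝ) => H.minEnergyOn (szSector (L ^ 2 - 2) 0) + H.minEnergyOn (szSector (L
/-- item stmt-HubbardSuperconductivity-10314 · crux · rank 4 · open · by planner
why it might fail: Asked ∀U∈[2,8] from 2-hole data only: filled λ=8 stripes win at δ=1/8 for U=6,8,12, t'=0 (1701.00054 p.6; QinEtAl2020 §IV); hole crystals/PS with pair charge gap may persist as δ→0⁺; (B) T=0 BEC of dilute 2D hard-core lattice bosons is open off the half-filled RP point (KLS1988, AizenmanEtAl2004).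
sources: arXiv:1701.00054, QinEtAl2020, ArovasBergKivelsonRaghu2022, KennedyLiebShastry1988, AizenmanEtAl2004, LiebYngvason2001
[crux] X -> S, the BEC-side bridge: for every U in [2,8], a pure-model Cooper pair in the sense
(a)(b)(c) (uniform in L=4k+4) implies d_{x^2-y^2} pair-field LRO of EVERY (N_L, S^z=0)-sector
ground-state sequence at some hole doping delta in (0,1/2), i.e. the summit's body at fixed (U,
delta) WRITTEN OUT VERBATIM (N_L = 2*floor((1-delta)L^2/2), normalised IsGroundStateInSector
sequences of hubbardTorus 2 L 1 U, HasLongRangeOrder of torusPullback (pairFieldCorr dWaveFormFactor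
psi) (2k) over halfOpenBox 2 (2k)) — definitionally the former conclusion
Literature.Barriers.HubbardSuperconductivity.HasDWavePairFieldLROAt U delta (Iff.rfl); inlined by
route-repair 2026-08-15 so that the route file no longer imports the Barriers module that carries
the registered open conjectures PureModelStripeCompetition / PureModelStripeCompetitionRange (never
hypotheses of this route). Content = (R) low-density reduction: at hole-pair density delta/2 <<
1/xi_p^2 the sector ground states are those of a dilute gas of hard-core d-bosons on the
antiferromagnetic background, with pair field = sqrt(Z_d) L (boson zero mode) + remainder, Z_d > 0
being exactly clause (c); and (B) DiluteBEC: ground-state ODLRO n_ -/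
@[route_item "route-HubbardSuperconductivity-CooperPairDMottWalk", crux]
def DiluteBECBridge : Prop :=
  open Literature.MathematicalPhysics.QuantumLattice in let CP := fun (L : ℕ) [NeZero L] (H : Matrix (Finset (Orb (FermionTorus 2 L))) (Finset (Orb (FermionTorus 2 L))) ℂ) (ε z : ℝ) => H.minEnergyOn (szSector (L ^ 2 - 2) 0) + H.minEnergyOn (szSector (L ^ 2) 0) + ε ≤ 2 * H.minEnergyOn (szSector (L ^ 2 - 1) (1 / 2)) ∧ (∀ φ₁ φ₂, IsGroundStateInSector H (L ^ 2 - 2) 0 φ₁ → IsGroundStateInSector H (L ^ 2 - 2) 0 φ₂ → ∃ c : ℂ, φ₂ = c • φ₁) ∧ (∀ φ₀ φ₂, IsGroundStateInSector H (L ^ 2) 0 φ₀ → IsGroundStateInSector H (L ^ 2 - 2) 0 φ₂ → z * (L : ℝ) ^ 2 * (star φ₀ ⬝ᵥ φ₀).re * (star φ₂ ⬝ᵥ φ₂).re ≤ ‖star φ₂ ⬝ᵥ (pairField dWaveFormFactor L *ᵥ φ₀)‖ ^ 2); ∀ U ∈ Set.Icc (2 : ℝ) 8, (∃ ε > (0 :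 ℝ), ∃ z > (0 : ℝ), ∃ k₀ : ℕ, ∀ k ≥ k₀, CP (4 * k + 4) (hubbardTorus 2 (4 * k + 4) 1 U) ε z) → ∃ δ ∈ Set.Ioo (0 : ℝ) (1 / 2), ∀ (N : ℕ → ℕ) (ψ : ∀ L, Fock (Orb (FermionTorus 2 L))), (∀ L, Even L → N L = 2 * ⌊(1 - δ) * (L : ℝ) ^ 2 / 2⌋₊ ∧ star (ψ L) ⬝ᵥ ψ L = 1 ∧ IsGroundStateInSector (hubbardTorus 2 L 1 U) (N L) 0 (ψ L)) → Literature.Probability.LatticeModels.HasLongRangeOrder (fun k => Literature.Probability.LatticeModels.halfOpenBox 2 (2 * k)) (fun k => torusPullback (pairFieldCorr dWaveFormFactor ψ) (2 * k))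

/-- item stmt-HubbardSuperconductivity-1179 · support · rank 9 · closed · proved by Summit.HubbardSuperconductivity.HubbardSuperconductivity.Theorems.CooperPairDMottWalk.breathingAtOneIsPure_proof @ e641d643db3a (prover) · by planner
sources: arXiv:0803.0933
[support] The breathing family at (a,b)=(1,1) IS the pure model: hamiltonian(intra) 1 U +
hamiltonian(inter) 1 0 = hubbardTorus 2 L 1 U for every L, U (the n.n. edge set is the disjoint
union intra u inter; the interaction term of the second summand is 0 * sum = 0). Provable now by
Finset sum splitting over `if (G \ P).Adj`/`if (G ⊓ P).Adj`; needed by any prover of BindingWalk.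
[folklore] -/
@[route_item "route-HubbardSuperconductivity-CooperPairDMottWalk"]
def BreathingAtOneIsPure : Prop :=
  open Literature.MathematicalPhysics.QuantumLattice in ∀ (L : ℕ) (U : ℝ), hamiltonian (fermionTorusGraph 2 L \ (⊤ : SimpleGraph (Fin 2 → ℕ)).comap (fun (x : FermionTorus 2 L) (i : Fin 2) => (ofLex x i : ℕ) / 2)) 1 U + hamiltonian (fermionTorusGraph 2 L ⊓ (⊤ : SimpleGraph (Fin 2 → ℕ)).comap (fun (x : FermionTorus 2 L) (i : Fin 2) => (ofLex x i : ℕ) / 2)) 1 0 = hubbardTorus 2 L 1 U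

-- `BreathingAtOneIsPure` holds: proved by `Summit.HubbardSuperconductivity.HubbardSuperconductivity.Theorems.CooperPairDMottWalk.breathingAtOneIsPure_proof` @ e641d643db3a (its module imports this route file, so no `_holds` link can be stated here).

/-- item stmt-HubbardSuperconductivity-1181 · support · rank 9 · open · by planner
sources: TsaiKivelson2006, arXiv:0803.0933, doi:10.1080/01418639608240361
[support] Plaquette data (certified computation, 256-dim): on the 2x2 torus = the 4-cycle plaquette
(hubbardTorus 2 2 1 U; torusGraph 2 2 is the 4-cycle) for every U in [2,4]: strict pair binding E_2
+ E_4 < 2 E_3 (sector minima (2,0),(4,0),(3,1/2); Delta_p>0 for 0<U<U_c~4.58, TsaiKivelson2006 /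
arXiv:0803.0933 Fig.5), unique ground states of the (N=2,S^z=0) and (N=4,S^z=0) sectors, and a
NONZERO d_{x^2-y^2} pair matrix element <phi_2, Delta_d phi_4> != 0 (Scalapino-Trugman
doi:10.1080/01418639608240361: the operator connecting the 2- and 4-electron plaquette ground states
has d_{x^2-y^2} symmetry). Blocks are <= 36-dimensional with entries polynomial in U; prove by
interval arithmetic on a U-grid plus eigenvalue-gap Lipschitz bounds, or symbolically. These numbers
(Delta_p(U), m_d(U)) are the zeroth order of CooperPairDMott; shared need with card
plaquette-pseudospin-lockin. -/
@[route_item "route-HubbardSuperconductivity-CooperPairDMottWalk"]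
def PlaquettePairBinding : Prop :=
  open Literature.MathematicalPhysics.QuantumLattice in ∀ U ∈ Set.Icc (2 : ℝ) 4, (hubbardTorus 2 2 1 U).minEnergyOn (szSector 2 0) + (hubbardTorus 2 2 1 U).minEnergyOn (szSector 4 0) < 2 * (hubbardTorus 2 2 1 U).minEnergyOn (szSector 3 (1 / 2)) ∧ (∀ φ₁ φ₂, IsGroundStateInSector (hubbardTorus 2 2 1 U) 2 0 φ₁ → IsGroundStateInSector (hubbardTorus 2 2 1 U) 2 0 φ₂ → ∃ c : ℂ, φ₂ = c • φ₁) ∧ (∀ φ₁ φ₂, IsGroundStateInSector (hubbardTorus 2 2 1 U) 4 0 φ₁ → IsGroundStateInSector (hubbardTorus 2 2 1 U) 4 0 φ₂ → ∃ c : ℂ, φ₂ = c • φ₁) ∧ (∀ φ₂ φ₄, IsGroundStateInSector (hubbardTorus 2 2 1 U) 2 0 φ₂ → IsGroundStateInSector (hubbardTorus 2 2 1 U) 4 0 φ₄ → star φ₂ ⬝ᵥ (pairField dWaveFormFactor 2 *ᵥ φ₄) ≠ 0)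

/-- item stmt-HubbardSuperconductivity-14352 · support · rank 9 · closed · proved by Summit.HubbardSuperconductivity.HubbardSuperconductivity.Theorems.CooperPairDMottWalk.cruxesGiveTarget_proof @ 564020c7aa99 (prover) · by planner
sources: arXiv:0803.0933, TsaiKivelson2006
[support] Glue, pure logic, provable now: CooperPairDMott → BindingWalk → PureCooperPair.
CooperPairDMott instantiated at U₀ = 2 ∈ [2,4] is literally the antecedent of BindingWalk (same
breathing family Hb, same Cooper-pair predicate CP, same quantifiers ∃ b₀ ∀ b ∈ (0,b₀) ∃ ε z k₀ ∀ k
≥ k₀), and BindingWalk's consequent is the body of PureCooperPair verbatim, so the thesis X =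
PureCooperPair is reached BY NAME from the two walk cruxes (term proof `fun hD hW => hW ⟨2, _, hD 2
_⟩`, checked in the planner's Sketch.lean). Filed by the route-choice repair of 2026-08-16 (operator
hold target-unreachable: no item of the route concluded PureCooperPair by name; BindingWalk only
inlined its body). [deps: CooperPairDMott, BindingWalk, PureCooperPair] [difficulty: provable-now]
[folklore] -/
@[route_item "route-HubbardSuperconductivity-CooperPairDMottWalk", crux]
def CruxesGiveTarget : Prop :=
  CooperPairDMott → BindingWalk → PureCooperPair

-- `CruxesGiveTarget` holds: proved by `Summit.HubbardSuperconductivity.HubbardSuperconductivity.Theorems.CooperPairDMottWalk.cruxesGiveTarget_proof` @ 564020c7aa99 (its module imports this route file, so no `_holds` link can be stated here).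

/-- item stmt-HubbardSuperconductivity-14353 · support · rank 9 · closed · proved by Summit.HubbardSuperconductivity.HubbardSuperconductivity.Theorems.CooperPairDMottWalk.targetSuffices_proof @ 564020c7aa99 (prover) · by planner
sources: ArovasBergKivelsonRaghu2022, Scalapino1995
[support] Glue, pure logic, provable now: PureCooperPair → DiluteBECBridge →
HubbardSuperconductivity. X gives some U ∈ [2,8] together with the pure-model Cooper-pair data (ε,
z, k₀) of hubbardTorus 2 L 1 U, L = 4k+4; DiluteBECBridge at that U turns exactly this data into
some δ ∈ (0,1/2) with d_{x²-y²} pair-field long-range order of every normalised (N_L, S^z=0)-sector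
ground-state sequence, N_L = 2⌊(1-δ)L²/2⌋, over the even sides — the summit's body
(Literature.Hubbard.DWaveSuperconductivityHubbard) with 0 < 2 ≤ U (term proof: obtain ⟨U,hU,hCP⟩ :=
hX; obtain ⟨δ,hδ,H⟩ := hB U hU hCP; exact ⟨U, _, δ, hδ, H⟩, checked in the planner's Sketch.lean).
With CruxesGiveTarget the deciding theorem becomes pure composition through the target: closes :
CooperPairDMott → BindingWalk → DiluteBECBridge → CruxesGiveTarget → TargetSuffices →
HubbardSuperconductivity. [deps: PureCooperPair, DiluteBECBridge] [difficulty: provable-now]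
[folklore] -/
@[route_item "route-HubbardSuperconductivity-CooperPairDMottWalk", crux]
def TargetSuffices : Prop :=
  PureCooperPair → DiluteBECBridge → _root_.HubbardSuperconductivity

-- `TargetSuffices` holds: proved by `Summit.HubbardSuperconductivity.HubbardSuperconductivity.Theorems.CooperPairDMottWalk.targetSuffices_proof` @ 564020c7aa99 (its module imports this route file, so no `_holds` link can be stated here).

/-- item stmt-HubbardSuperconductivity-15176 · support · rank 9 · closed · proved by Summit.HubbardSuperconductivity.HubbardSuperconductivity.Theorems.CooperPairDMottWalk.breathingSelfDualFourLe_proof (prover) · by operator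
[support] Repaired BreathingSelfDual (stmt-HubbardSuperconductivity-1180 was REFUTED AS TYPED by
Theorems.CooperPairDMottWalk.not_breathingSelfDual: at the degenerate side L = 2 the plaquette label
x -> (floor(x1/2), floor(x2/2)) is constant on the 2x2 torus, so every bond is intra-plaquette, Hb 2
0 1 0 = 0 while Hb 2 1 0 0 is the free 4-cycle hopping with one-particle entry -1, not unitarily
conjugate to 0). C' = the same conclusion under the extra hypothesis 4 <= L (the route only ever
uses sides L = 4k+4 >= 4): for even L >= 4 the diagonal translation x -> x+(1,1) maps the plaquette
tiling {2m,2m+1}^2 onto the complementary tiling, hence swaps intra- and inter-plaquette bonds, and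
the induced translation unitary W = U_(1,1) on Fock space (orbital permutation with its
Jordan-Wigner signs) conjugates H_L(a,b,U) to H_L(b,a,U) and commutes with N, S^z and the
translation-invariant d-wave pair field; the pure model a=b=1 is the self-dual point of the
breathing family. Why it might fail: it cannot at L >= 4 — the only degeneracy is L = 2 (one
plaquette = whole torus), excluded by the new hypothesis; C' is ALREADY PROVED in tree as
Literature.MathematicalPhysics.QuantumLattice.breathin -/
@[route_item "route-HubbardSuperconductivity-CooperPairDMottWalk"]
def BreathingSelfDualFourLe : Prop :=
  open Literature.MathematicalPhysics.QuantumLattice in let Hb := fun (L : ℕ) (a b U : ℝ) => hamiltonian (fermionTorusGraph 2 L \ (⊤ : SimpleGraph (Fin 2 → ℕ)).comap (fun (x : FermionTorus 2 L) (i : Fin 2) => (ofLex x i : ℕ) / 2)) a U + hamiltonian (fermionTorusGraph 2 L ⊓ (⊤ : SimpleGraph (Fin 2 → ℕ)).comap (fun (x : FermionTorus 2 L) (i : Fin 2) => (ofLex x i : ℕ) / 2)) b 0; ∀ (L : ℕ) [NeZero L] (a b U : ℝ), Even L → 4 ≤ L → ∃ W : Matrix (Finset (Orb (FermionTorus 2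 L))) (Finset (Orb (FermionTorus 2 L))) ℂ, W ∈ Matrix.unitaryGroup (Finset (Orb (FermionTorus 2 L))) ℂ ∧ W * Hb L a b U * star W = Hb L b a U ∧ W * totalNumber * star W = totalNumber ∧ W * HubbardWave0.spinZ * star W = HubbardWave0.spinZ ∧ W * pairField dWaveFormFactor L * star W = pairField dWaveFormFactor L

-- `BreathingSelfDualFourLe` holds: proved by `Summit.HubbardSuperconductivity.HubbardSuperconductivity.Theorems.CooperPairDMottWalk.breathingSelfDualFourLe_proof` (its module imports this route file, so no `_holds` link can be stated here).

/-- item stmt-HubbardSuperconductivity-1182 · assembly · rank 1 · closed · proved by Summit.HubbardSuperconductivity.HubbardSuperconductivity.Theorems.CooperPairDMottWalk.cooperPairDMottWalk_assembly_proof @ 564020c7aa99 (prover) · by planner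
sources: ArovasBergKivelsonRaghu2022
[assembly] CooperPairDMott -> BindingWalk -> DiluteBECBridge -> HubbardSuperconductivity. Pure
logic: CooperPairDMott at U0 = 2 gives BindingWalk's hypothesis; BindingWalk gives U in [2,8] with a
pure-model Cooper pair (= PureCooperPair); DiluteBECBridge gives delta in (0,1/2) with
HasDWavePairFieldLROAt U delta, which is definitionally the summit's body with 0 < 2 <= U. Checked
in the planner's Sketch.lean (5-line term proof). -/
@[route_item "route-HubbardSuperconductivity-CooperPairDMottWalk"]
def Assembly : Prop :=
  CooperPairDMott → BindingWalk → DiluteBECBridge → HubbardSuperconductivity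

-- `Assembly` holds: proved by `Summit.HubbardSuperconductivity.HubbardSuperconductivity.Theorems.CooperPairDMottWalk.cooperPairDMottWalk_assembly_proof` @ 564020c7aa99 (its module imports this route file, so no `_holds` link can be stated here).

-- records of items no longer active in this route (dropped / restated):
-- earlier BreathingSelfDual (stmt-HubbardSuperconductivity-1180, dropped 2026-08-16T12:17:43Z): refuted by Summit.HubbardSuperconductivity.HubbardSuperconductivity.Theorems.CooperPairDMottWalk.not_breathingSelfDual — open Literature.MathematicalPhysics.QuantumLattice in let Hb := fun (L : ℕ) (a b U : ℝ) => hamiltonian (fermionTorusGraph 2 L \ (⊤ : SimpleGraph (Fin 2 → ℕ)).comap (fun (x : FermionToru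

/-! D-0027 §2.1 — DECIDING THEOREM (planner-authored via `route open/edit --closes-file`; by operator:999:2573068 2026-08-16T11:57:41Z):
its hypotheses are this route's items and its conclusion the sub-problem Statement (glue_lint), and it elaborates with this file. -/

@[closes "route-HubbardSuperconductivity-CooperPairDMottWalk"] theorem closes : CooperPairDMott → BindingWalk → DiluteBECBridge → CruxesGiveTarget → TargetSuffices → _root_.HubbardSuperconductivity :=
  fun hDMott hWalk hBridge hCruxesGiveTarget hTargetSuffices =>
    hTargetSuffices (hCruxesGiveTarget hDMott hWalk) hBridge

end Summit.HubbardSuperconductivity.HubbardSuperconductivity.Theses.CooperPairDMottWalk
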